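import Literature.Computability.QuantumComplexity.ExactCompilerTowerCorrect
import Literature.Computability.QuantumComplexity.TwoQubitGadgetDensity
import HarnessLib

/-!
# The exact braid compiler: the two instances and their exact scores

Topic `Literature/Computability/QuantumComplexity`; sequel of `ExactCompilerTowerCorrect.lean`.
The compiler of the Jones-hardness reduction (Aharonov–Arad 2011 §3.3) runs twice: on the
one-qubit braid gates (`OneQubitBraidDensity`: `X = ρ(σ₁)ρ(σ₂)⁻¹`, `Y = ρ(σ₁)⁻¹ρ(σ₂)`, evaluation
`Matrix.map K5.toComplex`) and on the two-qubit gadget sector (`TwoQubitGadgetDensity`: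
`X = π(M'⁻¹)π(M)`, `Y = π(M')π(M⁻¹)`, evaluation the unitarisation `tildeOf`). This file packages
both as `EvalSpec`s over a four-letter alphabet (`Letter`: `x, y, x⁻¹, y⁻¹`) with well-formed
single-letter candidates, and proves the EXACT SCORE LAWS the descent needs
(`κ · toReal(score A) = Re tr(T† ev A)`):

* one-qubit targets `iH` (`scoreH = imC(A₀₀ + A₀₁ + A₁₀ - A₁₁)`, `κ = sin(2π/5)/√2`) and
  `iZ = diag(i, -i)` (`scoreZ = imC(A₀₀ - A₁₁)`, `κ = sin(2π/5)`);
* gadget targets `diag(u, ū)`: `u = -1` (`scoreCZ = -re2(A₀₀ + A₁₁)`, `κ = 1/2`), `u = i`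
  (`scoreZ`, `κ = sin(2π/5)`; the diagonal of `tildeOf A` is `toComplex` of the diagonal of
  `A`), `u = -i` (`-scoreZ`).

## References

* D. Aharonov, I. Arad, New J. Phys. 13 (2011) 035019, §3.2–§3.3, §4 [AharonovArad2011].
-/

noncomputable section

open scoped Matrix.Norms.L2Operator

namespace Literature.Computability.QuantumComplexity

open Matrix Complex QuadraticAlgebra

local notation "SU2" => Matrix.specialUnitaryGroup (Fin 2) ℂ
local notation "M2" => Matrix (Fin 2) (Fin 2) ℂ

namespace ExactCompiler

/-- The compiler's alphabet: two generators and their inverses. [folklore] -/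
inductive Letter
  | x | y | xi | yi
  deriving DecidableEq, Repr

/-- The inverse letter. [folklore] -/
def Letter.inv : Letter → Letter
  | x => xi
  | y => yi
  | xi => x
  | yi => y

/-! ### Generic facts: `K5` matrices mapped by `toComplex`, adjoints -/

/-- The adjoint over `K5` of a `ν`-unitary / unitary matrix gives a left inverse when it gives a
right inverse (square matrices). [folklore] -/
theorem adjK_mul_of_mul_adjK {M : Matrix (Fin 2) (Fin 2) K5} (h : M * K5.adjK M = 1) : K5.adjK M * M = 1 := by
  apply K5.map_injective
  rw [K5.map_mulK, Matrix.map_one _ (map_zero _) (map_one _)]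
  have h' : M.map K5.toComplex * (K5.adjK M).map K5.toComplex = 1 := by
    rw [← K5.map_mulK, h, Matrix.map_one _ (map_zero _) (map_one _)]
  exact mul_eq_one_comm.1 h'

/-- `det (adjK M) = conj (det M)` through `toComplex`. [folklore] -/
theorem det_map_adjK (M : Matrix (Fin 2) (Fin 2) K5) :
    ((K5.adjK M).map K5.toComplex).det = star ((M.map K5.toComplex).det) := by
  rw [K5.map_adjK, Matrix.star_eq_conjTranspose, Matrix.det_conjTranspose]

/-! ### The one-qubit instance -/

/-- Generator matrices of the one-qubit instance. [cite: AharonovArad2011, §4] -/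
def mat₁ : Letter → Matrix (Fin 2) (Fin 2) K5
  | Letter.x => X1K
  | Letter.y => Y1K
  | Letter.xi => K5.adjK X1K
  | Letter.yi => K5.adjK Y1K

/-- Every one-qubit generator maps into `SU(2)`. [cite: AharonovArad2011, §4] -/
theorem map_mat₁_mem (γ : Letter) : (mat₁ γ).map K5.toComplex ∈ Matrix.specialUnitaryGroup (Fin 2) ℂ := by
  rw [Matrix.mem_specialUnitaryGroup_iff]
  cases γ with
  | x => exact ⟨X1U.2, X1U_det⟩
  | y => exact ⟨Y1U.2, Y1U_det⟩
  | xi =>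
    refine ⟨?_, ?_⟩
    · rw [mat₁, K5.map_adjK]; exact Unitary.star_mem X1U.2
    · rw [mat₁, det_map_adjK]; change star ((X1U : M2).det) = 1; rw [X1U_det, star_one]
  | yi =>
    refine ⟨?_, ?_⟩
    · rw [mat₁, K5.map_adjK]; exact Unitary.star_mem Y1U.2
    · rw [mat₁, det_map_adjK]; change star ((Y1U : M2).det) = 1; rw [Y1U_det, star_one]

/-- **The one-qubit evaluation.** [cite: AharonovArad2011, §4] -/
def E₁ : EvalSpec Letter where
  mat₀ := mat₁
  evM := fun A => A.map K5.toComplex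
  evM_mul := K5.map_mulK
  evM_one := Matrix.map_one _ (map_zero _) (map_one _)
  trace_evM := K5.trace_mapK
  mem₀ := map_mat₁_mem

/-- The single-letter candidates of the one-qubit instance. [folklore] -/
def letterCand₁ (γ : Letter) : Cand Letter := ⟨[γ], mat₁ γ, [γ.inv], mat₁ γ.inv⟩

/-- They are well formed. [folklore] -/
theorem wf_letterCand₁ (γ : Letter) : (letterCand₁ γ).WF E₁.mat₀ := by
  refine ⟨by simp [letterCand₁, E₁], by simp [letterCand₁, E₁], ?_, ?_⟩ <;> cases γ <;>
    simp only [letterCand₁, Letter.inv, mat₁]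
  · exact X1K_mul_adjK
  · exact Y1K_mul_adjK
  · exact adjK_mul_of_mul_adjK X1K_mul_adjK
  · exact adjK_mul_of_mul_adjK Y1K_mul_adjK
  · exact adjK_mul_of_mul_adjK X1K_mul_adjK
  · exact adjK_mul_of_mul_adjK Y1K_mul_adjK
  · exact X1K_mul_adjK
  · exact Y1K_mul_adjK

/-! ### The gadget instance -/

/-- `X⁻¹`, `Y⁻¹` facts by kernel evaluation. [cite: AharonovArad2011, §4] -/
theorem X2invK_det : Gadget.X2invK.det = 1 := by decide +kernel
/-- `det Y⁻¹ = 1`. [cite: AharonovArad2011, §4] -/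
theorem Y2invK_det : Gadget.Y2invK.det = 1 := by decide +kernel
/-- `X⁻¹` is `ν`-unitary. [cite: AharonovArad2011, §4] -/
theorem X2invK_gram : K5.adjK Gadget.X2invK * Gadget.gramK * Gadget.X2invK = Gadget.gramK := by decide +kernel
/-- `Y⁻¹` is `ν`-unitary. [cite: AharonovArad2011, §4] -/
theorem Y2invK_gram : K5.adjK Gadget.Y2invK * Gadget.gramK * Gadget.Y2invK = Gadget.gramK := by decide +kernel

/-- Generator matrices of the gadget instance. [cite: AharonovArad2011, §4] -/
def mat₂ : Letter → Matrix (Fin 2) (Fin 2) K5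
  | Letter.x => Gadget.X2K
  | Letter.y => Gadget.Y2K
  | Letter.xi => Gadget.X2invK
  | Letter.yi => Gadget.Y2invK

/-- Every gadget generator unitarises into `SU(2)`. [cite: AharonovArad2011, §4] -/
theorem tildeOf_mat₂_mem (γ : Letter) : Gadget.tildeOf (mat₂ γ) ∈ Matrix.specialUnitaryGroup (Fin 2) ℂ := by
  rw [Matrix.mem_specialUnitaryGroup_iff]
  cases γ with
  | x => exact ⟨Gadget.tildeOf_mem_unitaryGroup Gadget.X2K_gram, by rw [mat₂, Gadget.det_tildeOf, Gadget.X2K_det, map_one]⟩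
  | y => exact ⟨Gadget.tildeOf_mem_unitaryGroup Gadget.Y2K_gram, by rw [mat₂, Gadget.det_tildeOf, Gadget.Y2K_det, map_one]⟩
  | xi => exact ⟨Gadget.tildeOf_mem_unitaryGroup X2invK_gram, by rw [mat₂, Gadget.det_tildeOf, X2invK_det, map_one]⟩
  | yi => exact ⟨Gadget.tildeOf_mem_unitaryGroup Y2invK_gram, by rw [mat₂, Gadget.det_tildeOf, Y2invK_det, map_one]⟩

/-- **The gadget evaluation.** [cite: AharonovArad2011, §3.2] -/
def E₂ : EvalSpec Letter where
  mat₀ := mat₂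
  evM := Gadget.tildeOf
  evM_mul := Gadget.tildeOf_mul
  evM_one := Gadget.tildeOf_one
  trace_evM := Gadget.trace_tildeOf
  mem₀ := tildeOf_mat₂_mem

/-- The single-letter candidates of the gadget instance. [folklore] -/
def letterCand₂ (γ : Letter) : Cand Letter := ⟨[γ], mat₂ γ, [γ.inv], mat₂ γ.inv⟩

/-- They are well formed. [folklore] -/
theorem wf_letterCand₂ (γ : Letter) : (letterCand₂ γ).WF E₂.mat₀ := by
  refine ⟨by simp [letterCand₂, E₂], by simp [letterCand₂, E₂], ?_, ?_⟩ <;> cases γ <;>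
    simp only [letterCand₂, Letter.inv, mat₂]
  · exact Gadget.X2K_mul_inv
  · exact Gadget.Y2K_mul_inv
  · exact Gadget.X2invK_mul
  · exact Gadget.Y2invK_mul
  · exact Gadget.X2invK_mul
  · exact Gadget.Y2invK_mul
  · exact Gadget.X2K_mul_inv
  · exact Gadget.Y2K_mul_inv

/-! ### Exact scores -/

/-- `scoreZ A = imC(A₀₀ - A₁₁)` (targets `diag(i, -i)`: `iZ` and `CS`). [cite: AharonovArad2011, §3.3] -/
def scoreZ (A : Matrix (Fin 2) (Fin 2) K5) : ZPhiS := K5.imC (A 0 0 - A 1 1)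

/-- `scoreZ' A = imC(A₁₁ - A₀₀)` (target `diag(-i, i)`: `CS†`). [cite: AharonovArad2011, §3.3] -/
def scoreZ' (A : Matrix (Fin 2) (Fin 2) K5) : ZPhiS := K5.imC (A 1 1 - A 0 0)

/-- `scoreCZ A = -re2(A₀₀ + A₁₁)` (target `-1`: `CZ`). [cite: AharonovArad2011, §3.3] -/
def scoreCZ (A : Matrix (Fin 2) (Fin 2) K5) : ZPhiS := -K5.re2 (A 0 0 + A 1 1)

/-- `scoreH A = imC(A₀₀ + A₀₁ + A₁₀ - A₁₁)` (target `iH`). [cite: AharonovArad2011, §3.3] -/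
def scoreH (A : Matrix (Fin 2) (Fin 2) K5) : ZPhiS := K5.imC (A 0 0 + A 0 1 + A 1 0 - A 1 1)

/-- `sin(2π/5) > 0`. [folklore] -/
theorem sin72_pos : 0 < Real.sin (2 * Real.pi / 5) := sin_two_pi_div_five_pos

/-- The target `diag(i, -i) ∈ SU(2)`. [folklore] -/
def targetZ : SU2 := torus (Real.pi / 2)

/-- The target `diag(-i, i) ∈ SU(2)`. [folklore] -/
def targetZ' : SU2 := torus (-(Real.pi / 2))

/-- The target `-1 ∈ SU(2)`. [folklore] -/
def targetCZ : SU2 := torus Real.pi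

/-- `diag(i,-i)` explicitly. [folklore] -/
theorem coe_targetZ : ((targetZ : SU2) : M2) = !![I, 0; 0, -I] := by
  rw [targetZ, coe_torus]; unfold diagMatrix
  rw [show ((Real.pi / 2 : ℝ) : ℂ) * I = (Real.pi / 2 : ℂ) * I by push_cast; ring,
    show ((-(Real.pi / 2) : ℝ) : ℂ) * I = -(Real.pi / 2 : ℂ) * I by push_cast; ring,
    Complex.exp_pi_div_two_mul_I, neg_mul, Complex.exp_neg, Complex.exp_pi_div_two_mul_I, Complex.inv_I]

/-- `diag(-i,i)` explicitly. [folklore] -/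
theorem coe_targetZ' : ((targetZ' : SU2) : M2) = !![-I, 0; 0, I] := by
  rw [targetZ', coe_torus]; unfold diagMatrix
  rw [neg_neg, show ((Real.pi / 2 : ℝ) : ℂ) * I = (Real.pi / 2 : ℂ) * I by push_cast; ring,
    show ((-(Real.pi / 2) : ℝ) : ℂ) * I = -(Real.pi / 2 : ℂ) * I by push_cast; ring,
    Complex.exp_pi_div_two_mul_I, neg_mul, Complex.exp_neg, Complex.exp_pi_div_two_mul_I, Complex.inv_I]

/-- `-1` explicitly. [folklore] -/
theorem coe_targetCZ : ((targetCZ : SU2) : M2) = !![-1, 0; 0, -1] := by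
  rw [targetCZ, coe_torus]; unfold diagMatrix
  rw [show ((-Real.pi : ℝ) : ℂ) * I = -(Real.pi * I) by push_cast; ring, Complex.exp_neg, Complex.exp_pi_mul_I]
  norm_num

/-- Real part of `-i z`: `Re(-i z) = Im z`; of `i z`: `-Im z`. [folklore] -/
theorem re_neg_I_mul (z : ℂ) : (-I * z).re = z.im := by simp
/-- `Re(i z) = -Im z`. [folklore] -/
theorem re_I_mul (z : ℂ) : (I * z).re = -z.im := by simp

/-- **Score law for `diag(i,-i)`, one-qubit evaluation**: `sin(2π/5) · toReal(scoreZ A) = Re tr(T† ev A)`.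
[cite: AharonovArad2011, §3.3] -/
theorem scoreZ_law₁ (A : Matrix (Fin 2) (Fin 2) K5) :
    Real.sin (2 * Real.pi / 5) * ZPhiS.toReal (scoreZ A) = ((star ((targetZ : SU2) : M2) * A.map K5.toComplex).trace).re := by
  rw [coe_targetZ, star_fin_two, Matrix.trace_fin_two]
  simp only [Matrix.mul_apply, Fin.sum_univ_two, Matrix.map_apply, Matrix.of_apply, Matrix.cons_val', Matrix.cons_val_zero,
    Matrix.cons_val_one, Matrix.empty_val', Matrix.cons_val_fin_one, Complex.conj_I, map_zero,
    map_neg, zero_mul, add_zero, zero_add, Complex.add_re, neg_neg, re_neg_I_mul, re_I_mul, scoreZ, K5.im_toComplex]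
  have : K5.imC (A 0 0 - A 1 1) = K5.imC (A 0 0) - K5.imC (A 1 1) := by
    simp [K5.imC]
  rw [this, map_sub]
  ring

/-- **Score law for `diag(-i,i)`, one-qubit evaluation.** [cite: AharonovArad2011, §3.3] -/
theorem scoreZ'_law₁ (A : Matrix (Fin 2) (Fin 2) K5) :
    Real.sin (2 * Real.pi / 5) * ZPhiS.toReal (scoreZ' A) = ((star ((targetZ' : SU2) : M2) * A.map K5.toComplex).trace).re := by
  rw [coe_targetZ', star_fin_two, Matrix.trace_fin_two]
  simp only [Matrix.mul_apply, Fin.sum_univ_two, Matrix.map_apply, Matrix.of_apply, Matrix.cons_val', Matrix.cons_val_zero,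
    Matrix.cons_val_one, Matrix.empty_val', Matrix.cons_val_fin_one, Complex.conj_I, map_zero,
    map_neg, zero_mul, add_zero, zero_add, Complex.add_re, neg_neg, re_neg_I_mul, re_I_mul, scoreZ', K5.im_toComplex]
  have : K5.imC (A 1 1 - A 0 0) = K5.imC (A 1 1) - K5.imC (A 0 0) := by
    simp [K5.imC]
  rw [this, map_sub]
  ring

/-- `det H2 = -1`. [folklore] -/
theorem det_H2 : H2.det = -1 := by
  unfold H2
  rw [Matrix.det_fin_two_of]
  have h := two_mul_invSqrtTwo_sq'
  linear_combination (-1 : ℂ) * h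

/-- The target `iH ∈ SU(2)`. [folklore] -/
def targetH : SU2 :=
  ⟨I • H2, Matrix.mem_specialUnitaryGroup_iff.2 ⟨by
    have : I • H2 = (I • (1 : M2)) * H2 := by rw [Matrix.smul_mul, Matrix.one_mul]
    rw [this]
    exact Submonoid.mul_mem _ (phase_mem_unitaryGroup (by simp)) H2_mem, by
    rw [Matrix.det_smul, det_H2, Fintype.card_fin]; simp⟩⟩

/-- Underlying matrix of `targetH`. [folklore] -/
theorem coe_targetH : ((targetH : SU2) : M2) = !![I * invSqrtTwo, I * invSqrtTwo; I * invSqrtTwo, -(I * invSqrtTwo)] := by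
  change I • H2 = _
  unfold H2
  ext i j
  fin_cases i <;> fin_cases j <;> simp

/-- **Score law for `iH`, one-qubit evaluation**: `κ = sin(2π/5)/√2`. [cite: AharonovArad2011, §3.3] -/
theorem scoreH_law₁ (A : Matrix (Fin 2) (Fin 2) K5) :
    (Real.sin (2 * Real.pi / 5) * invSqrtTwo) * ZPhiS.toReal (scoreH A) =
      ((star ((targetH : SU2) : M2) * A.map K5.toComplex).trace).re := by
  rw [coe_targetH, star_fin_two, Matrix.trace_fin_two]
  have hI' : ∀ z : ℂ, (I * (invSqrtTwo : ℂ) * z).re = -(invSqrtTwo * z.im) := by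
    intro z; simp [Complex.mul_re]
  simp only [Matrix.mul_apply, Fin.sum_univ_two, Matrix.map_apply, Matrix.of_apply, Matrix.cons_val', Matrix.cons_val_zero,
    Matrix.cons_val_one, Matrix.empty_val', Matrix.cons_val_fin_one, map_mul, Complex.conj_I, map_neg,
    Complex.conj_ofReal, Complex.add_re, neg_mul, neg_neg, hI', scoreH, K5.im_toComplex]
  have : K5.imC (A 0 0 + A 0 1 + A 1 0 - A 1 1) = K5.imC (A 0 0) + K5.imC (A 0 1) + K5.imC (A 1 0) - K5.imC (A 1 1) := by
    simp [K5.imC, QuadraticAlgebra.ext_iff]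
  rw [this, map_sub, map_add, map_add]
  have e2 : ∀ z : ℂ, (-(I * (invSqrtTwo : ℂ) * z)).re = invSqrtTwo * z.im := by
    intro z; simp [Complex.mul_re]
  simp only [e2, K5.im_toComplex]
  ring

/-- The positive constant of the `iH` law. [folklore] -/
theorem scoreH_const_pos : 0 < Real.sin (2 * Real.pi / 5) * invSqrtTwo := mul_pos sin72_pos invSqrtTwo_pos

/-! ### Scores on the gadget instance -/

/-- **The diagonal of the unitarisation is `toComplex` of the diagonal.** [cite: AharonovArad2011, §3.2] -/
theorem tildeOf_apply_zero_zero (A : Matrix (Fin 2) (Fin 2) K5) : Gadget.tildeOf A 0 0 = K5.toComplex (A 0 0) := by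
  unfold Gadget.tildeOf Gadget.dMat Gadget.dInv
  simp only [Matrix.mul_apply, Fin.sum_univ_two, Matrix.map_apply, Matrix.of_apply, Matrix.cons_val', Matrix.cons_val_zero,
    Matrix.cons_val_one, Matrix.empty_val', Matrix.cons_val_fin_one]
  ring

/-- The `(1,1)` entry of the unitarisation. [cite: AharonovArad2011, §3.2] -/
theorem tildeOf_apply_one_one (A : Matrix (Fin 2) (Fin 2) K5) : Gadget.tildeOf A 1 1 = K5.toComplex (A 1 1) := by
  have h : (Gadget.sqrtNu : ℂ) ≠ 0 := by exact_mod_cast Gadget.sqrtNu_pos.ne'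
  unfold Gadget.tildeOf Gadget.dMat Gadget.dInv
  simp only [Matrix.mul_apply, Fin.sum_univ_two, Matrix.map_apply, Matrix.of_apply, Matrix.cons_val', Matrix.cons_val_zero,
    Matrix.cons_val_one, Matrix.empty_val', Matrix.cons_val_fin_one]
  field_simp
  ring

/-- For diagonal targets, only the diagonal of `ev A` enters the trace. [folklore] -/
theorem trace_diag_mul (a b : ℂ) (P : M2) : ((!![a, 0; 0, b] : M2) * P).trace = a * P 0 0 + b * P 1 1 := by
  rw [Matrix.trace_fin_two]
  simp [Matrix.mul_apply, Fin.sum_univ_two]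

/-- **Score law for `CZ` (`u = -1`), gadget evaluation**: `(1/2) toReal(scoreCZ A) = Re tr((-1)† ev A)`.
[cite: AharonovArad2011, §3.3] -/
theorem scoreCZ_law₂ (A : Matrix (Fin 2) (Fin 2) K5) :
    (1 / 2 : ℝ) * ZPhiS.toReal (scoreCZ A) = ((star ((targetCZ : SU2) : M2) * Gadget.tildeOf A).trace).re := by
  rw [coe_targetCZ, star_fin_two]
  simp only [map_neg, map_one, map_zero]
  rw [trace_diag_mul, tildeOf_apply_zero_zero, tildeOf_apply_one_one, scoreCZ, map_neg, ← K5.two_mul_re_toComplex, map_add]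
  simp
  ring

/-- **Score law for `CS` (`u = i`), gadget evaluation.** [cite: AharonovArad2011, §3.3] -/
theorem scoreZ_law₂ (A : Matrix (Fin 2) (Fin 2) K5) :
    Real.sin (2 * Real.pi / 5) * ZPhiS.toReal (scoreZ A) = ((star ((targetZ : SU2) : M2) * Gadget.tildeOf A).trace).re := by
  rw [coe_targetZ, star_fin_two]
  simp only [map_neg, map_zero, Complex.conj_I, neg_neg]
  rw [trace_diag_mul, tildeOf_apply_zero_zero, tildeOf_apply_one_one, scoreZ]
  have : K5.imC (A 0 0 - A 1 1) = K5.imC (A 0 0) - K5.imC (A 1 1) := by simp [K5.imC]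
  rw [this, map_sub, Complex.add_re, re_neg_I_mul, re_I_mul, K5.im_toComplex, K5.im_toComplex]
  ring

/-- **Score law for `CS†` (`u = -i`), gadget evaluation.** [cite: AharonovArad2011, §3.3] -/
theorem scoreZ'_law₂ (A : Matrix (Fin 2) (Fin 2) K5) :
    Real.sin (2 * Real.pi / 5) * ZPhiS.toReal (scoreZ' A) = ((star ((targetZ' : SU2) : M2) * Gadget.tildeOf A).trace).re := by
  rw [coe_targetZ', star_fin_two]
  simp only [map_neg, map_zero, Complex.conj_I, neg_neg]
  rw [trace_diag_mul, tildeOf_apply_zero_zero, tildeOf_apply_one_one, scoreZ']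
  have : K5.imC (A 1 1 - A 0 0) = K5.imC (A 1 1) - K5.imC (A 0 0) := by simp [K5.imC]
  rw [this, map_sub, Complex.add_re, re_I_mul, re_neg_I_mul, K5.im_toComplex, K5.im_toComplex]
  ring

end ExactCompiler

end Literature.Computability.QuantumComplexity

end
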